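import Summits.Parity.GeneralizedHardyLittlewood.Theorems.LeeYangFibresPrimeCellsRelativeChowlaDefs
import Summits.Parity.GeneralizedHardyLittlewood.Theses.LiouvilleOpening
import Summits.Parity.GeneralizedHardyLittlewood.Theorems.LeeYangFibresAbsoluteUpgradeSinglesDecayThresholds
import HarnessLib

/-!
# Route `LeeYangFibres`, crux `PrimeCellsRelative` (stmt-Parity-14112), line `SketchIdeator4`
# (card `sieve-out-to-chowla`): the pair case of the parity input from the route `LiouvilleOpening`

A CROSS-ROUTE BRIDGE.  The line `SketchIdeator4` proves the crux from the route's `CellParityLaw` plus ONE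
conjecture-grade parity input `LiouvilleTupleMeanPos t` (vocabulary file
`Theorems/LeeYangFibresPrimeCellsRelativeChowlaDefs.lean`): a Bombieri–Vinogradov mean value, to level `N^η`, for the
class sums `Σ_{m ∈ I, m ≡ r_d (d)} ∏_{i ∈ S} λ(ψ_i(m))` of a non-degenerate one-dimensional system on integer intervals
`I ⊆ [−N, N]` where every form is `≥ 1`, with saving `(log N)^{-A}`.  At `t = 2` (the PAIR content of the crux) this
input follows from the two parity statements of the sibling route `LiouvilleOpening`:

* its crux `RelativeChowlaLevel` (Theses/LiouvilleOpening.lean) — the RELATIVE (mean-free) level of distribution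
  `N^{1−δ}` of the pair Chowla sequence `c_Ψ(n) = λ(ψ₁(n))λ(ψ₂(n))`:
  `Σ_{q ≤ N^{1−δ}} |Σ_{n ∈ [u,v], q ∣ n − r_q} c_Ψ(n) − (1/q) Σ_{n ∈ [u,v]} c_Ψ(n)| ≤ C N/(log N)^A`;
* log-power natural-density pair Chowla on intervals, `|Σ_{n ∈ [u,v]} c_Ψ(n)| ≤ C N/(log N)^A` (the second
  hypothesis of the theorem; a strengthening of the route's `ChowlaNatural`).

`liouvilleTupleMeanPos_two_of_relativeChowlaLevel` : the two together give `LiouvilleTupleMeanPos 2` with `η = 1/2`.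
Proof: on an interval where both forms are `≥ 1` the tuple sign `∏_i (−1)^{Ω(ψ_i(m).toNat)}` IS `c_Ψ(m)`
(`tupleSign_univ_eq_prod_liouville`) and `m ≡ r (d) ↔ d ∣ m − r`, so the class sum of the line is the progression sum
of `c_Ψ` (`classSum_univ_eq_sum_liouville`); per modulus `|A_d| ≤ |A_d − T/d| + |T|/d` (`T` the full interval sum), the
first part summed over `d ≤ N^{1/2}` is the relative level at `δ = 1/2`, the second is `|T| Σ_{d ≤ √N} 1/d ≤
|T| (1 + log N) ≤ 2 |T| log N` (`sum_Icc_one_div_le_one_add_log_nat`, Mathlib's `harmonic_le_one_add_log`), and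
`|T| ≤ C₂ N/(log N)^{A'+1}` pays for the logarithm (`sum_abs_le_of_relativeLevel`).  The only subset `S ⊆ [2]` with
`|S| ≥ 2` is `[2]` itself, and an empty interval contributes `0`.

Nothing is asserted about the truth of either hypothesis (both are open, conjecture-grade statements of the route
`LiouvilleOpening`, consumed here only as hypotheses).

References: Tao 2016 [TaoFMP2016] (log-averaged two-point Chowla: what is known towards the hypotheses);
Green–Tao 2010 [GreenTao2010] (normalisations of affine-linear systems).
-/

noncomputable section

open scoped BigOperators Classical
open Finset Filter

namespace Summit.Parity.GeneralizedHardyLittlewood.Cruxes.PrimeCellsRelative.SieveOutToChowla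

open Literature.NumberTheory.Sieve
open Summit.Parity.GeneralizedHardyLittlewood.Theorems.AbsoluteUpgrade (eventually_log_ge)

/-! ## Elementary pieces -/

/-- `∑_{d=1}^{D} 1/d ≤ 1 + log D` (Mathlib's `harmonic_le_one_add_log`, cast to `ℝ`). [folklore] -/
theorem sum_Icc_one_div_le_one_add_log_nat (D : ℕ) :
    ∑ d ∈ Finset.Icc 1 D, (1 : ℝ) / d ≤ 1 + Real.log D := by
  have h := harmonic_le_one_add_log D
  rw [harmonic_eq_sum_Icc, Rat.cast_sum] at h
  push_cast at h
  simpa only [one_div] using h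

/-- On an integer `m` where every form of the system is `≥ 1`, the tuple sign over ALL forms is the genuine
Liouville tuple `∏_i λ(ψ_i(m))` (`λ(n) = (−1)^{Ω(n)}` for `n ≠ 0`). [folklore] -/
theorem tupleSign_univ_eq_prod_liouville {t : ℕ} (Ψ : Fin t → AffLinForm 1) {m : ℤ}
    (hm : ∀ k, 1 ≤ (Ψ k).eval (fun _ => m)) :
    tupleSign Ψ Finset.univ m =
      ∏ i, ((ArithmeticFunction.liouville (Int.toNat ((Ψ i).eval fun _ => m)) : ℤ) : ℝ) := by
  unfold tupleSign
  refine Finset.prod_congr rfl fun i _ => ?_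
  have h0 : ((Ψ i).eval (fun _ => m)).toNat ≠ 0 := by
    have := hm i
    omega
  rw [ArithmeticFunction.liouville_apply h0]
  push_cast
  rfl

/-- On an integer interval where every form is `≥ 1`, the line's class sum over ALL forms to the modulus `d` and the
residue `r` is the progression sum `Σ_{n ∈ [m₁,m₂], d ∣ n − r} ∏_i λ(ψ_i(n))` of the Liouville tuple
(`m ≡ r (mod d) ↔ d ∣ m − r`). [folklore] -/
theorem classSum_univ_eq_sum_liouville {t : ℕ} (Ψ : Fin t → AffLinForm 1) {m₁ m₂ : ℤ}
    (hpos : ∀ m ∈ Finset.Icc m₁ m₂, ∀ k, 1 ≤ (Ψ k).eval (fun _ => m)) (d : ℕ) (r : ℤ) :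
    classSum Ψ Finset.univ m₁ m₂ d r =
      ∑ n ∈ (Finset.Icc m₁ m₂).filter (fun n : ℤ => (d : ℤ) ∣ n - r),
        ∏ i, ((ArithmeticFunction.liouville (Int.toNat ((Ψ i).eval fun _ => n)) : ℤ) : ℝ) := by
  unfold classSum
  refine Finset.sum_congr (Finset.ext fun m => ?_) fun m hm => ?_
  · rw [Finset.mem_filter, Finset.mem_filter, Int.modEq_iff_dvd, dvd_sub_comm]
  · exact tupleSign_univ_eq_prod_liouville Ψ (hpos m (Finset.mem_filter.mp hm).1)

/-- **Relative level + size of the total ⇒ absolute level (bookkeeping).** If `Σ_{d ≤ D} |F_d − T/d| ≤ B₁`,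
`|T| ≤ B₂` and `log D ≤ ℓ` with `ℓ ≥ 1`, then `Σ_{d ≤ D} |F_d| ≤ B₁ + 2 B₂ ℓ`
(`|F_d| ≤ |F_d − T/d| + |T|/d` and `Σ_{d ≤ D} 1/d ≤ 1 + log D ≤ 2ℓ`). [folklore] -/
theorem sum_abs_le_of_relativeLevel {D : ℕ} {F : ℕ → ℝ} {T B₁ B₂ ℓ : ℝ} (hℓ : 1 ≤ ℓ)
    (hD : Real.log D ≤ ℓ) (h1 : ∑ d ∈ Finset.Icc 1 D, |F d - T / d| ≤ B₁) (h2 : |T| ≤ B₂) :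
    ∑ d ∈ Finset.Icc 1 D, |F d| ≤ B₁ + B₂ * (2 * ℓ) := by
  have hB₂ : 0 ≤ B₂ := (abs_nonneg T).trans h2
  have hharm := sum_Icc_one_div_le_one_add_log_nat D
  have hsum0 : 0 ≤ ∑ d ∈ Finset.Icc 1 D, (1 : ℝ) / d := Finset.sum_nonneg fun d _ => by positivity
  have hterm : ∀ d ∈ Finset.Icc 1 D, |F d| ≤ |F d - T / d| + |T| * ((1 : ℝ) / d) := fun d _ => by
    have h := abs_add_le (F d - T / d) (T / d)
    rw [sub_add_cancel, abs_div, Nat.abs_cast] at h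
    have e : |T| / (d : ℝ) = |T| * (1 / d) := by ring
    linarith
  calc ∑ d ∈ Finset.Icc 1 D, |F d|
      ≤ ∑ d ∈ Finset.Icc 1 D, (|F d - T / d| + |T| * ((1 : ℝ) / d)) := Finset.sum_le_sum hterm
    _ = ∑ d ∈ Finset.Icc 1 D, |F d - T / d| + |T| * ∑ d ∈ Finset.Icc 1 D, (1 : ℝ) / d := by
        rw [Finset.sum_add_distrib, Finset.mul_sum]
    _ ≤ B₁ + B₂ * (1 + Real.log D) := add_le_add h1 (mul_le_mul h2 hharm hsum0 hB₂)
    _ ≤ B₁ + B₂ * (2 * ℓ) := by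
        have : 1 + Real.log D ≤ 2 * ℓ := by linarith
        nlinarith

/-! ## The bridge -/

/-- **The pair case of the line's parity input from the route `LiouvilleOpening`.**  `RelativeChowlaLevel` (relative
level of distribution `N^{1−δ}` of `c_Ψ(n) = λ(ψ₁(n))λ(ψ₂(n))`, every `δ > 0`, every log-power) together with
log-power natural-density pair Chowla on sub-intervals of `[−N, N]` implies `LiouvilleTupleMeanPos 2`, with level
exponent `η = 1/2`: given `L, A` put `A' = max A 1`, take the relative level at `δ = 1/2`, exponent `A'` and the
interval bound at exponent `A' + 1`; on an interval `[m₁, m₂] ⊆ [−N, N]` where both forms are `≥ 1` the class sums of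
the line ARE the progression sums of `c_Ψ` (`classSum_univ_eq_sum_liouville`; the only `S` with `|S| ≥ 2` is `[2]`),
and `Σ_{d ≤ √N sqfree} |A_d| ≤ Σ_{d ≤ √N} (|A_d − T/d| + |T|/d) ≤ C₁ N/(log N)^{A'} + 2 C₂ N log N/(log N)^{A'+1}
≤ (max(C₁,0) + 2|C₂|) N/(log N)^{A}` once `log N ≥ 1` (`sum_abs_le_of_relativeLevel`).  Both hypotheses are open,
conjecture-grade statements; nothing is asserted about them. [folklore] -/
theorem liouvilleTupleMeanPos_two_of_relativeChowlaLevel : Summit.Parity.GeneralizedHardyLittlewood.Theses.LiouvilleOpening.RelativeChowlaLevel → (∀ (L : ℕ) (A : ℝ), ∃ (C : ℝ) (N₀ : ℕ), ∀ N : ℕ, N₀ ≤ N → ∀ Ψ : Fin 2 → AffLinForm 1, IsNondegenerateSystem Ψ → affLinSize Ψ N ≤ L → ∀ u v : ℤ, -(N : ℤ) ≤ u → v ≤ N → |∑ n ∈ Finset.Icc u v, ∏ i, ((ArithmeticFunction.liouville (Int.toNat ((Ψ i).eval fun _ => n)) : ℤ) : ℝ)| ≤ C * (N : ℝ) / Real.log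 N ^ A) → LiouvilleTupleMeanPos 2 := by
  intro hR hT L A
  -- exponents: `A' = max A 1 ≥ 1`, relative level at `δ = 1/2`, exponent `A'`; totals at exponent `A' + 1`
  obtain ⟨A', hA'1, hAA'⟩ : ∃ A' : ℝ, 1 ≤ A' ∧ A ≤ A' := ⟨max A 1, le_max_right _ _, le_max_left _ _⟩
  obtain ⟨C₁, N₁, h1⟩ := hR L (1 / 2) A' (by norm_num) (by linarith)
  obtain ⟨C₂, N₂, h2⟩ := hT L (A' + 1)
  obtain ⟨N₀, hN₀⟩ := Filter.eventually_atTop.mp ((eventually_ge_atTop N₁).and ((eventually_ge_atTop N₂).and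
    ((eventually_ge_atTop 1).and (eventually_log_ge 1))))
  refine ⟨1 - 1 / 2, by norm_num, max C₁ 0 + 2 * |C₂|, N₀, fun N hN Ψ hΨ hL m₁ m₂ hI hpos S hS r => ?_⟩
  obtain ⟨hN1, hN2, hNone, hlog⟩ := hN₀ N hN
  -- the only `S ⊆ [2]` with two elements is `[2]`
  obtain rfl : S = Finset.univ :=
    Finset.eq_univ_of_card S (le_antisymm (Finset.card_le_univ S) (by rw [Fintype.card_fin]; exact hS))
  -- basic real facts at the scale `N`
  have hNr1 : (1 : ℝ) ≤ N := by exact_mod_cast hNone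
  have hN0 : (0 : ℝ) ≤ N := Nat.cast_nonneg N
  have hℓ1 : 1 ≤ Real.log N := hlog
  have hℓ0 : 0 < Real.log N := by linarith
  have hP : 0 < Real.log N ^ A' := Real.rpow_pos_of_pos hℓ0 _
  have hPA : 0 < Real.log N ^ A := Real.rpow_pos_of_pos hℓ0 _
  have hPle : Real.log N ^ A ≤ Real.log N ^ A' := Real.rpow_le_rpow_of_exponent_le hℓ1 hAA'
  have hC0 : 0 ≤ max C₁ 0 + 2 * |C₂| := by positivity
  have hRHS : 0 ≤ (max C₁ 0 + 2 * |C₂|) * N / Real.log N ^ A := div_nonneg (mul_nonneg hC0 hN0) hPA.le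
  -- an empty interval contributes nothing
  rcases (Finset.Icc m₁ m₂).eq_empty_or_nonempty with he | hne
  · have h0 : ∀ d : ℕ, classSum Ψ Finset.univ m₁ m₂ d (r d) = 0 := fun d => by
      unfold classSum
      rw [he, Finset.filter_empty, Finset.sum_empty]
    simp only [h0, abs_zero, Finset.sum_const_zero]
    exact hRHS
  -- a non-empty interval inside `[−N, N]`: the two hypotheses apply to `[m₁, m₂]`
  have hm : m₁ ≤ m₂ := by
    obtain ⟨m, hm⟩ := hne
    have := Finset.mem_Icc.mp hm
    omega
  obtain ⟨hu, hv⟩ := (Finset.Icc_subset_Icc_iff hm).mp hI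
  have hb1 := h1 N hN1 Ψ hΨ hL m₁ m₂ hu hv r
  have hb2 := h2 N hN2 Ψ hΨ hL m₁ m₂ hu hv
  -- `log ⌊N^{1/2}⌋ ≤ log N`
  have hD : Real.log (⌊(N : ℝ) ^ ((1 : ℝ) - 1 / 2)⌋₊ : ℕ) ≤ Real.log N := by
    have hle : ((⌊(N : ℝ) ^ ((1 : ℝ) - 1 / 2)⌋₊ : ℕ) : ℝ) ≤ N :=
      (Nat.floor_le (Real.rpow_nonneg hN0 _)).trans (by
        calc (N : ℝ) ^ ((1 : ℝ) - 1 / 2) ≤ (N : ℝ) ^ (1 : ℝ) := Real.rpow_le_rpow_of_exponent_le hNr1 (by norm_num)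
          _ = N := Real.rpow_one _)
    have hge : (1 : ℝ) ≤ ((⌊(N : ℝ) ^ ((1 : ℝ) - 1 / 2)⌋₊ : ℕ) : ℝ) := by
      have : 1 ≤ ⌊(N : ℝ) ^ ((1 : ℝ) - 1 / 2)⌋₊ :=
        Nat.le_floor (by rw [Nat.cast_one]; exact Real.one_le_rpow hNr1 (by norm_num))
      exact_mod_cast this
    exact Real.log_le_log (by linarith) hle
  -- the class sums of the line are the progression sums of `c_Ψ`
  have hclass := fun d : ℕ => classSum_univ_eq_sum_liouville Ψ hpos d (r d)
  simp only [hclass]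
  -- drop `Squarefree`, then the bookkeeping, then the constants
  refine le_trans (Finset.sum_le_sum_of_subset_of_nonneg (Finset.filter_subset _ _) fun _ _ _ => abs_nonneg _) ?_
  refine le_trans (sum_abs_le_of_relativeLevel hℓ1 hD hb1 hb2) ?_
  rw [Real.rpow_add_one hℓ0.ne' A']
  have step1 : C₁ * N / Real.log N ^ A' ≤ max C₁ 0 * N / Real.log N ^ A' :=
    div_le_div_of_nonneg_right (mul_le_mul_of_nonneg_right (le_max_left _ _) hN0) hP.le
  have step2 : C₂ * (N : ℝ) / (Real.log N ^ A' * Real.log N) * (2 * Real.log N) ≤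
      2 * |C₂| * N / Real.log N ^ A' := by
    rw [div_mul_eq_mul_div, div_le_div_iff₀ (mul_pos hP hℓ0) hP]
    nlinarith [mul_nonneg (sub_nonneg.2 (le_abs_self C₂)) (mul_nonneg (mul_nonneg hN0 hℓ0.le) hP.le),
      mul_pos hP hℓ0]
  calc C₁ * N / Real.log N ^ A' + C₂ * N / (Real.log N ^ A' * Real.log N) * (2 * Real.log N)
      ≤ max C₁ 0 * N / Real.log N ^ A' + 2 * |C₂| * N / Real.log N ^ A' := add_le_add step1 step2
    _ = (max C₁ 0 + 2 * |C₂|) * N / Real.log N ^ A' := by ring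
    _ ≤ (max C₁ 0 + 2 * |C₂|) * N / Real.log N ^ A :=
        div_le_div_of_nonneg_left (mul_nonneg hC0 hN0) hPA hPle

end Summit.Parity.GeneralizedHardyLittlewood.Cruxes.PrimeCellsRelative.SieveOutToChowla

end
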